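import Summits.NavierStokesRegularity.NavierStokesRegularity.Theorems.BoundedTemperatureClosed.Negative.BoundedTemperatureClosedFalseOfTypeIInfimumNotAttainedNS
import Summits.NavierStokesRegularity.NavierStokesRegularity.Theorems.EulerProximatePump.Negative.HeatOnSegment
import Summits.NavierStokesRegularity.NavierStokesRegularity.Theorems.PumpContinuationBoundedTemperatureClosedSchwartzData
import Literature.Analysis.FluidPDE.TaoAveragedSobolevProofs

/-!
# Crux `BoundedTemperatureClosed` (stmt-NavierStokesRegularity-18303), negative side:
# the `H¹⁰_df`-data relaxation of the crux (bite-table row (g)) and Schwartz saturation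

Planner-facing support lemmas of line lead a1 (line `SketchIdeator4`, ideator k = 4, card
`gkp-critical-temperature`). That line proves the crux from two stubs,

* RELAXED CLOSEDNESS — the crux with its Schwartz data relaxed to all of Tao's `H¹⁰_df`
  (`∀ 𝒜 sym canc, ∀ M, IsClosed btSetH10[𝒜, M]`), and
* SCHWARTZ SATURATION — every `H¹⁰_df`-datum bounded-temperature blow-up of a segment operator is
  matched by a Schwartz-datum one at the same operator and ceiling (`btSetH10[𝒜, M] ⊆ btSet[𝒜, M]`),

and this file locates, in the kernel, the open Navier–Stokes content each stub carries (Sketch-dead O1):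

* `boundedTemperatureClosed_of_relaxedClosedH10_of_schwartzSaturationH10` — the two stubs give the crux
  (the crux's set is sandwiched: `btSet ⊆ btSetH10` because Schwartz divergence-free data ARE `H¹⁰_df`
  data, landed `memH10df_schwartzL2`), hence (`…_false_of_typeIInfimumNotAttainedNS`, same directory)
  `not_relaxedClosedH10_and_schwartzSaturationH10_of_typeIInfimumNotAttainedNS`: `H → ¬(both)`;
* `mem_btSetH10_iff_of_form_eq_zero`, `zero_not_mem_btSetH10_of_form_eq_zero` — at a form-zero datum
  (segment `T_θ = θ·B`) the RELAXED set is `{θ ∈ (0,1] | nsTypeIH10[θM]}`: membership of `θ > 0` is an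
  `H¹⁰_df`-data `H¹⁰_df`-mild Type-I blow-up of Navier–Stokes at ceiling `θM` (amplitude rescaling of
  `H¹⁰_df` witnesses, `typeIWitnessH10_smul`), and the heat point `θ = 0` is never a member (the free heat
  flow of the initial slice extends every mild solution of the zero form, landed
  `eq_heat_of_isMildSolutionFor_zeroForm`);
* `nsTypeIH10_of_forall_lt_of_isClosed`, `not_forall_pos_nsTypeIH10_of_isClosed`,
  `nsTypeIH10_of_forall_lt_of_relaxedClosedH10` — hence RELAXED CLOSEDNESS alone proves ATTAINMENT of the
  infimal Type-I ceiling of Navier–Stokes over `H¹⁰_df` data (and an `H¹⁰_df` temperature floor): the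
  `H¹⁰_df` twin of `¬ TypeIInfimumNotAttainedNS`, i.e. the relaxed stub is crux-sized (it is the crux over a
  larger data class);
* `nsTypeI_of_nsTypeIH10_of_schwartzSaturationH10` — SCHWARTZ SATURATION alone, read at the Euler datum
  (constant segment `T_θ = B`, landed `segForm_euler_eq`), is exact Schwartz re-entry of Navier–Stokes
  Type-I blow-ups at EVERY ceiling: `nsTypeIH10[K] → nsTypeI[K]` (no `η`-loss);
* `nsTypeIH10_of_nsTypeI`, `btSet_subset_btSetH10` — the trivial directions.

Nothing here closes the item and no conclusion asserts a Theses decl unconditionally (`--supports`).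

## References

* T. Tao, J. Amer. Math. Soc. 29 (2016), arXiv:1402.0290v3, §1.1 (1.13), (1.15). [`Tao2016AveragedNS`]
* W. Rusin, V. Šverák, J. Funct. Anal. 260 (2011) 879–891, arXiv:0911.0500, §1 question (Q) (minimal blow-up
  data: the data-side attainment question whose Type-I-ceiling analogue over `H¹⁰_df` data is isolated here).
  [`RusinSverak2011`]
-/

noncomputable section

-- the nested summit namespace `…NavierStokesRegularity.NavierStokesRegularity…` is the tree's layout
-- (D-0017), so the duplicated-namespace linter must be silenced for every declaration below
set_option linter.dupNamespace false

namespace Summit.NavierStokesRegularity.NavierStokesRegularity.Theorems.BoundedTemperatureClosed.Negative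

open MeasureTheory Set Filter Topology
open scoped ENNReal
open Literature.Analysis.FluidPDE Literature.Analysis.FluidPDE.Tao2016
open Literature.Analysis.FunctionSpaces (eFourierSobolevNorm)
open Summit.NavierStokesRegularity.NavierStokesRegularity.Theses.PumpContinuation
open Summit.NavierStokesRegularity.NavierStokesRegularity.Theorems.PumpContinuationEulerProximatePump
  (isMildSolutionFor_smul smul_inv_of_smul inv_smul_smul_ofReal)
open Summit.NavierStokesRegularity.NavierStokesRegularity.Theorems.PerpetualPumpEulerTypeIGlue
  (eLpNorm_coe_const_smul)
open Summit.NavierStokesRegularity.NavierStokesRegularity.Theorems.EulerProximatePump.Negative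
  (continuousInH10On_heat eq_heat_of_isMildSolutionFor_zeroForm zero_isSymmetric zero_hasCancellation)
open Summit.NavierStokesRegularity.NavierStokesRegularity.Theorems.PumpContinuationSchwartzData
  (memH10df_schwartzL2)

/-- The bounded-temperature blow-up set of the datum `𝒜` at ceiling `M` along the segment
`T_θ = (1-θ)·B̃_𝒜 + θ·B` — verbatim the set whose closedness the crux asserts (Schwartz data). -/
local notation3 "btSet[" 𝒜 ", " M "]" =>
  {θ : ℝ | θ ∈ Set.Icc (0 : ℝ) 1 ∧
    ∃ u₀ : SchwartzMap (EuclideanSpace ℝ (Fin 3)) (EuclideanSpace ℝ (Fin 3)),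
      Literature.Analysis.FluidPDE.VectorCalculus.IsDivFree ⇑u₀ ∧ ∃ S : ℝ, 0 < S ∧
      ∃ u : ℝ → Literature.Analysis.FluidPDE.Tao2016.L2C,
        Literature.Analysis.FluidPDE.Tao2016.IsMildSolutionFor
          (fun a b c => ((1 - θ : ℝ) : ℂ) * AveragingDatum.form 𝒜 a b c +
            ((θ : ℝ) : ℂ) * Literature.Analysis.FluidPDE.Tao2016.eulerForm a b c)
          (Literature.Analysis.FluidPDE.Tao2016.schwartzL2 u₀) (Set.Ico 0 S) u ∧
        (∀ t ∈ Set.Ico 0 S, MeasureTheory.eLpNorm (u t) ⊤ MeasureTheory.volume ≤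
          ENNReal.ofReal (M / Real.sqrt (S - t))) ∧
        ¬ ∃ S' : ℝ, S < S' ∧ ∃ v : ℝ → Literature.Analysis.FluidPDE.Tao2016.L2C,
          Literature.Analysis.FluidPDE.Tao2016.IsMildSolutionFor
            (fun a b c => ((1 - θ : ℝ) : ℂ) * AveragingDatum.form 𝒜 a b c +
              ((θ : ℝ) : ℂ) * Literature.Analysis.FluidPDE.Tao2016.eulerForm a b c)
            (Literature.Analysis.FluidPDE.Tao2016.schwartzL2 u₀) (Set.Ico 0 S') v ∧
          ∀ t ∈ Set.Ico 0 S, v t = u t}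

/-- The RELAXED bounded-temperature blow-up set of the datum `𝒜` at ceiling `M`: the same set with the
Schwartz datum replaced by an arbitrary `H¹⁰_df` datum `a` (line `SketchIdeator4`'s `btSetIn h10Data`). -/
local notation3 "btSetH10[" 𝒜 ", " M "]" =>
  {θ : ℝ | θ ∈ Set.Icc (0 : ℝ) 1 ∧
    ∃ a : Literature.Analysis.FluidPDE.Tao2016.L2C, Literature.Analysis.FluidPDE.Tao2016.MemH10df a ∧
      ∃ S : ℝ, 0 < S ∧ ∃ u : ℝ → Literature.Analysis.FluidPDE.Tao2016.L2C,
        Literature.Analysis.FluidPDE.Tao2016.IsMildSolutionFor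
          (fun a b c => ((1 - θ : ℝ) : ℂ) * AveragingDatum.form 𝒜 a b c +
            ((θ : ℝ) : ℂ) * Literature.Analysis.FluidPDE.Tao2016.eulerForm a b c)
          a (Set.Ico 0 S) u ∧
        (∀ t ∈ Set.Ico 0 S, MeasureTheory.eLpNorm (u t) ⊤ MeasureTheory.volume ≤
          ENNReal.ofReal (M / Real.sqrt (S - t))) ∧
        ¬ ∃ S' : ℝ, S < S' ∧ ∃ v : ℝ → Literature.Analysis.FluidPDE.Tao2016.L2C,
          Literature.Analysis.FluidPDE.Tao2016.IsMildSolutionFor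
            (fun a b c => ((1 - θ : ℝ) : ℂ) * AveragingDatum.form 𝒜 a b c +
              ((θ : ℝ) : ℂ) * Literature.Analysis.FluidPDE.Tao2016.eulerForm a b c)
            a (Set.Ico 0 S') v ∧
          ∀ t ∈ Set.Ico 0 S, v t = u t}

/-- Navier–Stokes has a SCHWARTZ-data `H¹⁰_df`-mild Type-I blow-up at ceiling `M` with no mild extension
(the crux's membership predicate at the Euler end `θ = 1`). -/
local notation3 "nsTypeI[" M "]" =>
  ∃ u₀ : SchwartzMap (EuclideanSpace ℝ (Fin 3)) (EuclideanSpace ℝ (Fin 3)),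
    Literature.Analysis.FluidPDE.VectorCalculus.IsDivFree ⇑u₀ ∧ ∃ S : ℝ, 0 < S ∧
    ∃ u : ℝ → Literature.Analysis.FluidPDE.Tao2016.L2C,
      Literature.Analysis.FluidPDE.Tao2016.IsMildSolutionFor
        Literature.Analysis.FluidPDE.Tao2016.eulerForm
        (Literature.Analysis.FluidPDE.Tao2016.schwartzL2 u₀) (Set.Ico 0 S) u ∧
      (∀ t ∈ Set.Ico 0 S, MeasureTheory.eLpNorm (u t) ⊤ MeasureTheory.volume ≤
        ENNReal.ofReal (M / Real.sqrt (S - t))) ∧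
      ¬ ∃ S' : ℝ, S < S' ∧ ∃ v : ℝ → Literature.Analysis.FluidPDE.Tao2016.L2C,
        Literature.Analysis.FluidPDE.Tao2016.IsMildSolutionFor
          Literature.Analysis.FluidPDE.Tao2016.eulerForm
          (Literature.Analysis.FluidPDE.Tao2016.schwartzL2 u₀) (Set.Ico 0 S') v ∧
        ∀ t ∈ Set.Ico 0 S, v t = u t

/-- Navier–Stokes has an `H¹⁰_df`-DATA `H¹⁰_df`-mild Type-I blow-up at ceiling `M` with no mild extension
(the relaxed membership predicate at the Euler end `θ = 1`). -/
local notation3 "nsTypeIH10[" M "]" =>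
  ∃ a : Literature.Analysis.FluidPDE.Tao2016.L2C, Literature.Analysis.FluidPDE.Tao2016.MemH10df a ∧
    ∃ S : ℝ, 0 < S ∧ ∃ u : ℝ → Literature.Analysis.FluidPDE.Tao2016.L2C,
      Literature.Analysis.FluidPDE.Tao2016.IsMildSolutionFor
        Literature.Analysis.FluidPDE.Tao2016.eulerForm a (Set.Ico 0 S) u ∧
      (∀ t ∈ Set.Ico 0 S, MeasureTheory.eLpNorm (u t) ⊤ MeasureTheory.volume ≤
        ENNReal.ofReal (M / Real.sqrt (S - t))) ∧
      ¬ ∃ S' : ℝ, S < S' ∧ ∃ v : ℝ → Literature.Analysis.FluidPDE.Tao2016.L2C,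
        Literature.Analysis.FluidPDE.Tao2016.IsMildSolutionFor
          Literature.Analysis.FluidPDE.Tao2016.eulerForm a (Set.Ico 0 S') v ∧
        ∀ t ∈ Set.Ico 0 S, v t = u t

/-- RELAXED CLOSEDNESS (line `SketchIdeator4`'s stub `stub_relaxedClosedH10`, i.e. `RelaxedClosedIn h10Data`):
the crux with Schwartz data relaxed to `H¹⁰_df` data. -/
local notation3 "relaxedClosedH10" =>
  ∀ 𝒜 : AveragingDatum, 𝒜.IsSymmetric → 𝒜.HasCancellation → ∀ M : ℝ, IsClosed btSetH10[𝒜, M]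

/-- SCHWARTZ SATURATION (line `SketchIdeator4`'s `SchwartzSaturationIn h10Data`): every `H¹⁰_df`-datum
bounded-temperature blow-up parameter is a Schwartz-datum one, same operator, same ceiling. -/
local notation3 "schwartzSaturationH10" =>
  ∀ 𝒜 : AveragingDatum, 𝒜.IsSymmetric → 𝒜.HasCancellation → ∀ M : ℝ, btSetH10[𝒜, M] ⊆ btSet[𝒜, M]

/-! ### Amplitude rescaling of `H¹⁰_df`-data witnesses -/

/-- **Scaling of an `H¹⁰_df`-data mild Type-I blow-up with no extension** (the `H¹⁰_df`-datum twin of the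
landed `typeIBlowup_smul`). For `c > 0` and `T'(c a, c b, w) = c · T(a, b, w)`: an `H¹⁰_df` datum `a`, a time
`S > 0` and a `T`-mild solution `u` on `[0,S)` from `a` with `‖u t‖_∞ ≤ M/√(S-t)` and no `T`-mild extension
yield the same for `T'` at ceiling `c M` (datum `c • a ∈ H¹⁰_df`, curve `c • u`; an extension of `c • u` for
`T'` rescales by `c⁻¹` to an extension of `u` for `T`). [cite: Tao2016AveragedNS, §1.1 (1.15)] -/
theorem typeIWitnessH10_smul (T T' : L2C → L2C → L2C → ℂ) {c : ℝ} (hc : 0 < c)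
    (hT : ∀ a b w : L2C, T' (((c : ℝ) : ℂ) • a) (((c : ℝ) : ℂ) • b) w = ((c : ℝ) : ℂ) * T a b w)
    (M : ℝ)
    (h : ∃ a : L2C, MemH10df a ∧ ∃ S : ℝ, 0 < S ∧ ∃ u : ℝ → L2C,
      IsMildSolutionFor T a (Ico 0 S) u ∧
      (∀ t ∈ Ico 0 S, eLpNorm (u t) ⊤ volume ≤ ENNReal.ofReal (M / Real.sqrt (S - t))) ∧
      ¬ ∃ S' : ℝ, S < S' ∧ ∃ v : ℝ → L2C,
          IsMildSolutionFor T a (Ico 0 S') v ∧ ∀ t ∈ Ico 0 S, v t = u t) :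
    ∃ a : L2C, MemH10df a ∧ ∃ S : ℝ, 0 < S ∧ ∃ u : ℝ → L2C,
      IsMildSolutionFor T' a (Ico 0 S) u ∧
      (∀ t ∈ Ico 0 S, eLpNorm (u t) ⊤ volume ≤ ENNReal.ofReal (c * M / Real.sqrt (S - t))) ∧
      ¬ ∃ S' : ℝ, S < S' ∧ ∃ v : ℝ → L2C,
          IsMildSolutionFor T' a (Ico 0 S') v ∧ ∀ t ∈ Ico 0 S, v t = u t := by
  obtain ⟨a, ha, S, hS, u, hu, hrate, hnoext⟩ := h
  have hc0 : c ≠ 0 := hc.ne'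
  refine ⟨((c : ℝ) : ℂ) • a, ha.smul c, S, hS, fun t => ((c : ℝ) : ℂ) • u t,
    isMildSolutionFor_smul T T' c hT _ _ _ hu, ?_, ?_⟩
  · -- the Type-I rate at ceiling `c M`
    intro t ht
    have hcn : ‖((c : ℝ) : ℂ)‖ₑ = ENNReal.ofReal c := by
      rw [← ofReal_norm, Complex.norm_real, Real.norm_eq_abs, abs_of_nonneg hc.le]
    show eLpNorm (((((c : ℝ) : ℂ) • u t : L2C)) : EuclideanSpace ℝ (Fin 3) → EuclideanSpace ℂ (Fin 3))
        ⊤ volume ≤ ENNReal.ofReal (c * M / Real.sqrt (S - t))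
    rw [eLpNorm_coe_const_smul, hcn]
    calc ENNReal.ofReal c * eLpNorm (u t : EuclideanSpace ℝ (Fin 3) → EuclideanSpace ℂ (Fin 3)) ⊤ volume
        ≤ ENNReal.ofReal c * ENNReal.ofReal (M / Real.sqrt (S - t)) :=
          mul_le_mul_right (hrate t ht) _
      _ = ENNReal.ofReal (c * M / Real.sqrt (S - t)) := by
          rw [← ENNReal.ofReal_mul hc.le, mul_div_assoc]
  · -- no `T'`-mild extension of `c • u`: rescale one back by `c⁻¹`
    rintro ⟨S', hSS', v, hv, hvu⟩
    refine hnoext ⟨S', hSS', fun t => ((c⁻¹ : ℝ) : ℂ) • v t, ?_, fun t ht => ?_⟩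
    · have h2 := isMildSolutionFor_smul T' T c⁻¹ (smul_inv_of_smul T T' hc0 hT) _ _ _ hv
      rwa [inv_smul_smul_ofReal hc0] at h2
    · show ((c⁻¹ : ℝ) : ℂ) • v t = u t
      have h3 : v t = ((c : ℝ) : ℂ) • u t := hvu t ht
      rw [h3, inv_smul_smul_ofReal hc0]

/-! ### The relaxed set of a form-zero datum is the rescaled `H¹⁰_df` ceiling set of Navier–Stokes -/

/-- **Relaxed membership at `θ > 0` for a form-zero datum is an `H¹⁰_df`-data Navier–Stokes statement.** If
the form of `𝒜` vanishes identically, then for `0 < θ ≤ 1`: `θ ∈ btSetH10[𝒜, M] ↔ nsTypeIH10[θM]` (the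
segment form is `θ·B` on the diagonal; `u ↦ θ^{±1} u`, `typeIWitnessH10_smul`). [cite: Tao2016AveragedNS, §1.1 (1.15)] -/
theorem mem_btSetH10_iff_of_form_eq_zero {𝒜 : AveragingDatum} (h0 : ∀ u v w : L2C, 𝒜.form u v w = 0)
    {θ : ℝ} (hθ : 0 < θ) (hθ1 : θ ≤ 1) (M : ℝ) :
    θ ∈ btSetH10[𝒜, M] ↔ nsTypeIH10[θ * M] := by
  have hdiag : ∀ a c : L2C, ((1 - θ : ℝ) : ℂ) * 𝒜.form a a c + ((θ : ℝ) : ℂ) * eulerForm a a c =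
      ((θ : ℝ) : ℂ) * eulerForm a a c := fun a c => by
    rw [h0, mul_zero, zero_add]
  have hT1 : ∀ a b w : L2C, eulerForm (((θ : ℝ) : ℂ) • a) (((θ : ℝ) : ℂ) • b) w =
      ((θ : ℝ) : ℂ) * (((θ : ℝ) : ℂ) * eulerForm a b w) := fun a b w => by
    rw [eulerForm_smul_smul]
    ring
  have hT2 : ∀ a b w : L2C, ((θ : ℝ) : ℂ) * eulerForm (((θ⁻¹ : ℝ) : ℂ) • a) (((θ⁻¹ : ℝ) : ℂ) • b) w =
      ((θ⁻¹ : ℝ) : ℂ) * eulerForm a b w := fun a b w => by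
    rw [eulerForm_smul_smul, Complex.ofReal_inv]
    field_simp
  simp only [mem_setOf_eq,
    isMildSolutionFor_congr_diag
      (T := fun a b c => ((1 - θ : ℝ) : ℂ) * 𝒜.form a b c + ((θ : ℝ) : ℂ) * eulerForm a b c)
      (T' := fun a b c => ((θ : ℝ) : ℂ) * eulerForm a b c) hdiag]
  constructor
  · rintro ⟨-, hw⟩
    exact typeIWitnessH10_smul (fun a b c => ((θ : ℝ) : ℂ) * eulerForm a b c) eulerForm hθ hT1 M hw
  · intro hw
    have h := typeIWitnessH10_smul eulerForm (fun a b c => ((θ : ℝ) : ℂ) * eulerForm a b c)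
      (inv_pos.2 hθ) hT2 (θ * M) hw
    rw [← mul_assoc, inv_mul_cancel₀ hθ.ne', one_mul] at h
    exact ⟨⟨hθ.le, hθ1⟩, h⟩

/-- **The heat point is never a relaxed member.** If the form of `𝒜` vanishes identically, then at `θ = 0`
the segment form is the zero form (heat equation) on the diagonal, and every `H¹⁰_df`-mild solution `u` of
it on `[0,S)` — from ANY datum — is extended to `[0,S+1)` by the free heat flow of its initial slice
`u 0 ∈ H¹⁰_df` (landed `eq_heat_of_isMildSolutionFor_zeroForm`, `continuousInH10On_heat`), contradicting
the no-extension clause. [cite: Tao2016AveragedNS, §1.1 (1.15)] -/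
theorem zero_not_mem_btSetH10_of_form_eq_zero {𝒜 : AveragingDatum} (h0 : ∀ u v w : L2C, 𝒜.form u v w = 0)
    (M : ℝ) : (0 : ℝ) ∉ btSetH10[𝒜, M] := by
  have hdiag : ∀ a c : L2C, ((1 - (0 : ℝ) : ℝ) : ℂ) * 𝒜.form a a c + (((0 : ℝ) : ℝ) : ℂ) * eulerForm a a c =
      (fun _ _ _ : L2C => (0 : ℂ)) a a c := fun a c => by
    rw [h0]
    push_cast
    ring
  simp only [mem_setOf_eq,
    isMildSolutionFor_congr_diag
      (T := fun a b c => ((1 - (0 : ℝ) : ℝ) : ℂ) * 𝒜.form a b c + (((0 : ℝ) : ℝ) : ℂ) * eulerForm a b c)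
      (T' := fun _ _ _ : L2C => (0 : ℂ)) hdiag]
  rintro ⟨-, a, -, S, hS, u, hu, -, hno⟩
  have h0S : (0 : ℝ) ∈ Ico 0 S := ⟨le_rfl, hS⟩
  have ha : MemH10df (u 0) := hu.1 0 h0S
  refine hno ⟨S + 1, by linarith, fun t => heat t (u 0), ⟨fun t _ => ha.heat t,
    continuousInH10On_heat ha.1 _, fun t _ w hw => ?_⟩, fun t ht => ?_⟩
  · simp only [intervalIntegral.integral_zero, add_zero]
    rw [pairing_heat_left, pairing_heat_left]
    exact hu.initial h0S (hw.heat t)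
  · exact (eq_heat_of_isMildSolutionFor_zeroForm hu h0S ht).symm

/-! ### `H¹⁰_df`-data Navier–Stokes Type-I ceilings: up-set, Schwartz ones included -/

/-- **Monotonicity in the ceiling** (`H¹⁰_df` data): an `M`-witness is an `M'`-witness for `M ≤ M'`. [folklore] -/
theorem nsTypeIH10_mono {M M' : ℝ} (h : M ≤ M') (hM : nsTypeIH10[M]) : nsTypeIH10[M'] := by
  obtain ⟨a, ha, S, hS, u, hu, hrate, hno⟩ := hM
  exact ⟨a, ha, S, hS, u, hu, fun t ht => (hrate t ht).trans
    (ENNReal.ofReal_le_ofReal (div_le_div_of_nonneg_right h (Real.sqrt_nonneg _))), hno⟩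

/-- **Schwartz witnesses are `H¹⁰_df` witnesses**: a complexified divergence-free Schwartz datum is an
`H¹⁰_df` datum (landed `memH10df_schwartzL2`). [cite: Tao2016AveragedNS, §1.1] -/
theorem nsTypeIH10_of_nsTypeI {M : ℝ} (h : nsTypeI[M]) : nsTypeIH10[M] := by
  obtain ⟨u₀, hdiv, hrest⟩ := h
  exact ⟨schwartzL2 u₀, memH10df_schwartzL2 u₀ hdiv, hrest⟩

/-- **The crux's set lies in the relaxed set**, for every datum and ceiling (same reason). [cite: Tao2016AveragedNS, §1.1] -/
theorem btSet_subset_btSetH10 (𝒜 : AveragingDatum) (M : ℝ) : btSet[𝒜, M] ⊆ btSetH10[𝒜, M] := by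
  rintro θ ⟨hθ, u₀, hdiv, hrest⟩
  exact ⟨hθ, schwartzL2 u₀, memH10df_schwartzL2 u₀ hdiv, hrest⟩

/-! ### Relaxed closedness at a form-zero datum ⇒ `H¹⁰_df`-attainment and an `H¹⁰_df` temperature floor -/

/-- **`H¹⁰_df`-attainment from relaxed closedness at a form-zero datum.** If the relaxed sets of a form-zero
datum are closed, a positive ceiling `m` all of whose strict upper ceilings carry `H¹⁰_df`-data mild Type-I
blow-ups of Navier–Stokes carries one itself (at ceiling `2m` the members `(1/2,1]` accumulate at `1/2`).
[cite: RusinSverak2011, §1 question (Q)] -/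
theorem nsTypeIH10_of_forall_lt_of_isClosed {𝒜 : AveragingDatum} (h0 : ∀ u v w : L2C, 𝒜.form u v w = 0)
    (hcl : ∀ M : ℝ, IsClosed btSetH10[𝒜, M]) {m : ℝ} (hm : 0 < m)
    (h : ∀ M : ℝ, m < M → nsTypeIH10[M]) : nsTypeIH10[m] := by
  have hsub : Ioc (1 / 2 : ℝ) 1 ⊆ btSetH10[𝒜, 2 * m] := fun θ hθ =>
    (mem_btSetH10_iff_of_form_eq_zero h0 (by linarith [hθ.1]) hθ.2 (2 * m)).2
      (h _ (by nlinarith [hθ.1]))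
  have hmem : (1 / 2 : ℝ) ∈ btSetH10[𝒜, 2 * m] := by
    refine (hcl (2 * m)).closure_subset_iff.2 hsub ?_
    rw [closure_Ioc (by norm_num)]
    exact ⟨le_rfl, by norm_num⟩
  have h' := (mem_btSetH10_iff_of_form_eq_zero h0 (by norm_num) (by norm_num) (2 * m)).1 hmem
  rwa [show (1 / 2 : ℝ) * (2 * m) = m by ring] at h'

/-- **`H¹⁰_df` temperature floor from relaxed closedness at a form-zero datum**: Navier–Stokes cannot have
`H¹⁰_df`-data mild Type-I blow-ups at every positive ceiling (at ceiling `1` all of `(0,1]` would be members,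
accumulating at the non-member heat point). [cite: Tao2016AveragedNS, §1.1 (1.15)] -/
theorem not_forall_pos_nsTypeIH10_of_isClosed {𝒜 : AveragingDatum} (h0 : ∀ u v w : L2C, 𝒜.form u v w = 0)
    (hcl : ∀ M : ℝ, IsClosed btSetH10[𝒜, M]) : ¬ ∀ M : ℝ, 0 < M → nsTypeIH10[M] := by
  intro h
  have hsub : Ioc (0 : ℝ) 1 ⊆ btSetH10[𝒜, 1] := fun θ hθ =>
    (mem_btSetH10_iff_of_form_eq_zero h0 hθ.1 hθ.2 1).2 (h _ (by rw [mul_one]; exact hθ.1))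
  have hmem : (0 : ℝ) ∈ btSetH10[𝒜, 1] := by
    refine (hcl 1).closure_subset_iff.2 hsub ?_
    rw [closure_Ioc zero_ne_one]
    exact ⟨le_rfl, zero_le_one⟩
  exact zero_not_mem_btSetH10_of_form_eq_zero h0 1 hmem

/-- **The RELAXED-CLOSEDNESS stub alone proves `H¹⁰_df`-attainment of the infimal Type-I ceiling of
Navier–Stokes** (apply the previous lemma at the zero averaging datum `AveragingDatum.zero`, symmetric and
cancelling): the `H¹⁰_df` twin of `¬ TypeIInfimumNotAttainedNS`. So line `SketchIdeator4`'s stub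
`stub_relaxedClosedH10` is crux-sized (it is the crux over the larger data class `H¹⁰_df`).
[cite: RusinSverak2011, §1 question (Q)] -/
theorem nsTypeIH10_of_forall_lt_of_relaxedClosedH10 (hR : relaxedClosedH10) {m : ℝ} (hm : 0 < m)
    (h : ∀ M : ℝ, m < M → nsTypeIH10[M]) : nsTypeIH10[m] :=
  nsTypeIH10_of_forall_lt_of_isClosed AveragingDatum.zero_form
    (hR AveragingDatum.zero zero_isSymmetric zero_hasCancellation) hm h

/-- **The RELAXED-CLOSEDNESS stub alone proves an `H¹⁰_df` temperature floor for Navier–Stokes.**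
[cite: Tao2016AveragedNS, §1.1 (1.15)] -/
theorem not_forall_pos_nsTypeIH10_of_relaxedClosedH10 (hR : relaxedClosedH10) :
    ¬ ∀ M : ℝ, 0 < M → nsTypeIH10[M] :=
  not_forall_pos_nsTypeIH10_of_isClosed AveragingDatum.zero_form
    (hR AveragingDatum.zero zero_isSymmetric zero_hasCancellation)

/-! ### Schwartz saturation at the Euler datum = exact Schwartz re-entry at every ceiling -/

/-- **The SCHWARTZ-SATURATION stub alone is exact Schwartz re-entry of Navier–Stokes Type-I blow-ups**: at
the Euler datum the segment is constant, `T_θ = B` (landed `segForm_euler_eq`), so saturation at `θ = 1`,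
ceiling `K`, turns every `H¹⁰_df`-data mild Type-I blow-up of Navier–Stokes at ceiling `K` into a
SCHWARTZ-data one at the SAME ceiling (no `η`-loss). [cite: Tao2016AveragedNS, §1.1 (1.13)] -/
theorem nsTypeI_of_nsTypeIH10_of_schwartzSaturationH10 (hS : schwartzSaturationH10) {K : ℝ}
    (h : nsTypeIH10[K]) : nsTypeI[K] := by
  have h1 : (1 : ℝ) ∈ btSetH10[AveragingDatum.euler, K] := by
    simp only [mem_setOf_eq, segForm_euler_eq]
    exact ⟨⟨zero_le_one, le_rfl⟩, h⟩
  have h2 : (1 : ℝ) ∈ btSet[AveragingDatum.euler, K] :=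
    hS AveragingDatum.euler AveragingDatum.euler_isSymmetric AveragingDatum.euler_hasCancellation K h1
  simp only [mem_setOf_eq, segForm_euler_eq] at h2
  exact h2.2

/-! ### The two stubs together: the crux, hence `¬ TypeIInfimumNotAttainedNS` -/

/-- **Relaxed closedness + Schwartz saturation ⇒ the crux** (line `SketchIdeator4`'s transfer, in the tree's
vocabulary): the crux's set is sandwiched between the relaxed set (`btSet_subset_btSetH10`) and itself
(saturation), so it IS the relaxed set, which is closed. [cite: Tao2016AveragedNS, §1.1 (1.13)] -/
theorem boundedTemperatureClosed_of_relaxedClosedH10_of_schwartzSaturationH10 (hR : relaxedClosedH10)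
    (hS : schwartzSaturationH10) : BoundedTemperatureClosed := by
  intro 𝒜 hs hc M
  have heq : btSet[𝒜, M] = btSetH10[𝒜, M] :=
    Subset.antisymm (btSet_subset_btSetH10 𝒜 M) (hS 𝒜 hs hc M)
  show IsClosed btSet[𝒜, M]
  rw [heq]
  exact hR 𝒜 hs hc M

/-- **`H → ¬(relaxed closedness ∧ Schwartz saturation)`**: the conjunction of line `SketchIdeator4`'s two
non-trivial stubs proves the crux, which is false modulo the registered open statement
`TypeIInfimumNotAttainedNS` (landed `boundedTemperatureClosed_false_of_typeIInfimumNotAttainedNS`); so the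
line carries `¬H` exactly in these two stubs (Sketch-dead O1 located for this line).
[cite: RusinSverak2011, §1 question (Q)] -/
theorem not_relaxedClosedH10_and_schwartzSaturationH10_of_typeIInfimumNotAttainedNS
    (hH : TypeIInfimumNotAttainedNS) : ¬ (relaxedClosedH10 ∧ schwartzSaturationH10) := fun h =>
  boundedTemperatureClosed_false_of_typeIInfimumNotAttainedNS hH
    (boundedTemperatureClosed_of_relaxedClosedH10_of_schwartzSaturationH10 h.1 h.2)

/-- **Under `H`, Schwartz saturation refutes relaxed closedness directly at the zero datum** (the same
content unbundled: `H` supplies `K > 0` with all `K' > K` Schwartz ceilings, hence `H¹⁰_df` ceilings;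
relaxed closedness attains `K` over `H¹⁰_df`; saturation re-enters Schwartz at `K` — contradiction).
[cite: RusinSverak2011, §1 question (Q)] -/
theorem not_relaxedClosedH10_of_schwartzSaturationH10_of_typeIInfimumNotAttainedNS
    (hH : TypeIInfimumNotAttainedNS) (hS : schwartzSaturationH10) : ¬ relaxedClosedH10 := fun hR => by
  obtain ⟨K, hK, hnot, hall⟩ := hH
  exact hnot (nsTypeI_of_nsTypeIH10_of_schwartzSaturationH10 hS
    (nsTypeIH10_of_forall_lt_of_relaxedClosedH10 hR hK fun K' hK' => nsTypeIH10_of_nsTypeI (hall K' hK')))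

end Summit.NavierStokesRegularity.NavierStokesRegularity.Theorems.BoundedTemperatureClosed.Negative

end
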